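import Summits.HodgeConjecture.HodgeConjecture.Theorems.K2E1bCDPseudoCoeffOfParts           -- ★ p857662 (K2E1b-plan (g4) cand, filed K2-defs1 (g4)): `GlobalizationCohUnitaryStmt` (U8e-4), `IsCohUnitaryIrrep`
import Summits.HodgeConjecture.HodgeConjecture.Theorems.K2E1bUnitarityDescends            -- ★ 8b-δ p857177 (K2E4-p10 (g3)): `hasInvariantHermitianForm_of_gkEquiv` (transport of an invariant Hermitian form)
import Summits.HodgeConjecture.HodgeConjecture.Theorems.F0P3bStubT3aUnitaryAlongPOfHermitian  -- ★ T3a₄: `stubT3aUnitaryAlongPOfHermitian_holds` (invariant Hermitian form ⇒ `IsUnitaryAlongP`)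
import Literature.NumberTheory.Automorphic.UnitaryGlobalizationIrreducibleNoAdm            -- ★ `isTopIrreducible_of_isUnitaryGlobalization` (no admissible witness needed)
import Literature.NumberTheory.Automorphic.GKModulesAdmissibleUnitaryTwoOne                -- ★ `isAdmissibleGK_of_irreducible_unitary_uFormGroup_two_one` (Harish-Chandra admissibility at `U(2,1)`, PROVED)
import Literature.NumberTheory.Automorphic.UnitaryAdmissibleIrreducibleSubmoduleAnalytic   -- ★ `isInfUnitary_harishChandra`
import Literature.NumberTheory.Automorphic.GKModulesAdmissible                             -- ★ `AreGKEquivalent.isAdmissibleGK_iff`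
import Literature.RepresentationTheory.KonnoKonno2007.JunctionCartanDecomposition          -- ★ `uFormGroup_hasCartanDecomposition`
import HarnessLib

/-!
# K2 ∕ E1b tier 1 · unit U8e «CD PSEUDO-COEFFICIENT PARTS» — brick 8a-4 ∕ socket U8e-4 «A GLOBALIZED CLASS IS COH-UNITARY»

Cell hodgecm-mathlib, Track B «K2-LIT», engine E1b = «(𝔤,K)-cohomology of U(2,1)»; crux item h413 = stmt-HodgeConjecture-24833; K2-lead (g1) CHAIR
RULING R19 «8a IN-HOUSE PARTS (LIMITED)» (2026-09-04T05:10:13Z); unit U8e `Cruxes/H413/Lines/K2_E1b_GKCohomologyU21_U8e_CDPseudoCoeffParts.lean` ED. 1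
(K2E1b-plan (g4), 05:46Z) hosts four sockets whose ★ composition `cdPseudoCoeffWith_of_parts` (`Theorems/K2E1bCDPseudoCoeffOfParts.lean`, p857662) pays
socket 8a; U8e-1∕U8e-2 are ★ (brick «8a-1», p857666, K2-defs1 (g4)).  THIS FILE (desk K2-defs1 (g4); deal «8a-4» of K2E1b-plan (g4) 05:46:26Z on
K2-lead (g1)'s pre-deal 05:11:39Z) PAYS **U8e-4 `sig_K2E1bGlobalizationCohUnitary : GlobalizationCohUnitaryStmt`** BY NAME:

  `globalizationCohUnitary : GlobalizationCohUnitaryStmt` — if the `(𝔤,K)`-class `x` of `U(2,1)` has a unitary globalization `ϖ` (★ `IsUnitaryGlobalization`: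
  unitary, strongly continuous, Harish-Chandra module `(𝔤,K)`-equivalent to a representative `r` of `x`), then that representative is COH-UNITARY
  (★ `IsCohUnitaryIrrep r.ρK r.ρ𝔤`: a `(𝔤,K)`-module, irreducible, admissible, unitary along `𝔭 ⊕ ℝz₀`).

THE PROOF (all inputs ★, S–M transport): `r` is a `(𝔤,K)`-module and irreducible by the fields of ★ `GKIrrep`.  ADMISSIBLE: `ϖ` is topologically irreducible
(★ `isTopIrreducible_of_isUnitaryGlobalization`, Knapp–Vogan Thm. 0.4 read without an admissible witness), so its Harish-Chandra module `H_K^∞(ϖ)` is admissible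
(★ `isAdmissibleGK_of_irreducible_unitary_uFormGroup_two_one`, Harish-Chandra's admissibility theorem at `U(2,1)` via Gelfand's trick), and admissibility passes
along the `(𝔤,K)`-equivalence `H_K^∞(ϖ) ≃ r` (★ `AreGKEquivalent.isAdmissibleGK_iff`).  UNITARY ALONG `𝔭 ⊕ ℝz₀`: the restricted inner product makes
`H_K^∞(ϖ)` infinitesimally unitary (★ `isInfUnitary_harishChandra`: a positive-definite Hermitian form for which `dϖ(𝔤)` is skew), this invariant Hermitian form
is pulled back along the equivalence (★ `hasInvariantHermitianForm_of_gkEquiv`, 8b-δ), and its real part is the bilinear form of ★ `IsUnitaryAlongP`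
(★ T3a₄ `stubT3aUnitaryAlongPOfHermitian_holds`).  Same road as ★ `isUnitaryGlobalization_clInfChoiceU_of_archIsotypy` (`F0P3ArchBlockClassOfArchIsotypy` §4),
read at the representative instead of at `H_K^∞`.
THEOREMS ONLY (no `def`, no `instance`, no notation, no `sorry`, no axiom beyond the standard trio); lane `--supports stmt-HodgeConjecture-24833 --as helper`
(count-neutral).
References: [HarishChandra1953] Harish-Chandra, Trans. AMS 75 (1953), §9 Thms. 4–6, Thm. 8; [KnappVogan1995] A. W. Knapp, D. A. Vogan, *Cohomological Induction
and Unitary Representations* (1995), Introduction Thm. 0.4, §II.4; [BorelWallach2000] A. Borel, N. Wallach, *Continuous Cohomology, Discrete Subgroups, and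
Representations of Reductive Groups*, 2nd ed. (2000), 0 §2.5, II §2.1; [Rogawski1990] J. Rogawski, *Automorphic Representations of Unitary Groups in Three
Variables* (1990), Prop. 13.8.1 p. 206, Prop. 15.2.1 (b).
HONEST LABEL: HC_CM is proved only modulo the 7 printed citations (2 remaining named inputs: hLiu418 = stmt-HodgeConjecture-24832,
h413 = stmt-HodgeConjecture-24833) until rung 0 closes; this count-neutral helper pays the ★-adjacent socket U8e-4; 8a then hinges on U8e-3 alone
(the Clozel–Delorme core, XL letter-grade) — isolated, not removed.
-/

set_option autoImplicit false
set_option linter.dupNamespace false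

noncomputable section

namespace Summit.HodgeConjecture.HodgeConjecture.Cruxes.H413.K2E1bGKCohomologyU21.U8

open Literature.NumberTheory.Automorphic
open Literature.RepresentationTheory.KonnoKonno2007 Literature.RepresentationTheory.KonnoKonno2007.RealDualPair
open Summit.HodgeConjecture.HodgeConjecture.Cruxes.H413.F0P3bArchDegOnePackage (IsCohUnitaryIrrep IsUnitaryAlongP)
open Summit.HodgeConjecture.HodgeConjecture.Cruxes.H413.F0P3bLocalAPacketsDefs (HasInvariantHermitianForm)
open Summit.HodgeConjecture.HodgeConjecture.Cruxes.H413.F0P3bStubT3aUnitaryAlongPOfHermitian (stubT3aUnitaryAlongPOfHermitian_holds)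
open Summit.HodgeConjecture.HodgeConjecture.Cruxes.H413.K2E1bUnitarityDescends (hasInvariantHermitianForm_of_gkEquiv)

/-! ## §1 The two transported properties -/

/-- **The Harish-Chandra module of a unitary globalization of a class of `U(2,1)` is admissible**: the globalization is topologically irreducible
(★ `isTopIrreducible_of_isUnitaryGlobalization`) and Harish-Chandra's admissibility theorem at `U(2,1)` applies (★
`isAdmissibleGK_of_irreducible_unitary_uFormGroup_two_one`). [cite: HarishChandra1953, §9 Thm. 4] [cite: KnappVogan1995, Introduction Thm. 0.4, Thm. 0.6] -/
theorem isAdmissibleGK_harishChandra_of_isUnitaryGlobalization {x : GKIrrClass (uFormGroup (Fin 2) (Fin 1))}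
    {E : Type} [NormedAddCommGroup E] [InnerProductSpace ℂ E] [CompleteSpace E]
    {ϖ : ContRepresentation ℂ ↥(uFormGroup (Fin 2) (Fin 1)).carrier E} (hϖ : IsUnitaryGlobalization (uFormGroup (Fin 2) (Fin 1)) x ϖ) :
    IsAdmissibleGK (harishChandraRepK (uFormGroup (Fin 2) (Fin 1)) ϖ) :=
  isAdmissibleGK_of_irreducible_unitary_uFormGroup_two_one ϖ isStarFormallyReal_complex (uFormGroup_hasCartanDecomposition (Fin 2) (Fin 1))
    hϖ.isUnitary hϖ.isStronglyContinuous (isTopIrreducible_of_isUnitaryGlobalization x hϖ)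

/-- **A representative `(𝔤,K)`-equivalent to the Harish-Chandra module of a unitary globalization is admissible** (★ `AreGKEquivalent.isAdmissibleGK_iff`).
[cite: BorelWallach2000, 0 §2.4–2.5] [cite: HarishChandra1953, §9 Thm. 4] -/
theorem isAdmissibleGK_of_areGKEquivalent_harishChandra {E : Type} [NormedAddCommGroup E] [InnerProductSpace ℂ E] [CompleteSpace E]
    {ϖ : ContRepresentation ℂ ↥(uFormGroup (Fin 2) (Fin 1)).carrier E} {x : GKIrrClass (uFormGroup (Fin 2) (Fin 1))}
    (hϖ : IsUnitaryGlobalization (uFormGroup (Fin 2) (Fin 1)) x ϖ) (hc : ϖ.IsStronglyContinuous) (r : GKIrrep (uFormGroup (Fin 2) (Fin 1)))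
    (heq : AreGKEquivalent (harishChandraRepK (uFormGroup (Fin 2) (Fin 1)) ϖ) (harishChandraRepLie (uFormGroup (Fin 2) (Fin 1)) ϖ hc) r.ρK r.ρ𝔤) :
    IsAdmissibleGK r.ρK :=
  heq.isAdmissibleGK_iff.1 (isAdmissibleGK_harishChandra_of_isUnitaryGlobalization hϖ)

/-- **A representative `(𝔤,K)`-equivalent to the Harish-Chandra module of a unitary representation is unitary along `𝔭 ⊕ ℝz₀`**: the restricted inner product
is an invariant positive-definite Hermitian form on `H_K^∞(ϖ)` (★ `isInfUnitary_harishChandra`), pulled back along the equivalence (★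
`hasInvariantHermitianForm_of_gkEquiv`) and read as ★ `IsUnitaryAlongP` (★ `stubT3aUnitaryAlongPOfHermitian_holds`).
[cite: BorelWallach2000, 0 §2.5; II §2.1] [cite: KnappVogan1995, §II.4] -/
theorem isUnitaryAlongP_of_areGKEquivalent_harishChandra {E : Type} [NormedAddCommGroup E] [InnerProductSpace ℂ E] [CompleteSpace E]
    {ϖ : ContRepresentation ℂ ↥(uFormGroup (Fin 2) (Fin 1)).carrier E} (hu : ϖ.IsUnitary) (hc : ϖ.IsStronglyContinuous)
    (r : GKIrrep (uFormGroup (Fin 2) (Fin 1)))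
    (heq : AreGKEquivalent (harishChandraRepK (uFormGroup (Fin 2) (Fin 1)) ϖ) (harishChandraRepLie (uFormGroup (Fin 2) (Fin 1)) ϖ hc) r.ρK r.ρ𝔤) :
    IsUnitaryAlongP r.ρ𝔤 := by
  obtain ⟨eqv⟩ := heq
  obtain ⟨B, hB₁, hB₂, hB₃, -⟩ := isInfUnitary_harishChandra hu hc
  have hH : HasInvariantHermitianForm (harishChandraRepLie (uFormGroup (Fin 2) (Fin 1)) ϖ hc) := ⟨B, hB₁, hB₂, hB₃⟩
  obtain ⟨H, hH₁, hH₂, hH₃⟩ := hasInvariantHermitianForm_of_gkEquiv eqv hH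
  exact stubT3aUnitaryAlongPOfHermitian_holds (Fin 2) (Fin 1) r.V r.ρ𝔤 ⟨H, hH₁, hH₂, hH₃⟩

/-! ## §2 The head: socket U8e-4 -/

/-- **(U8e-4) A GLOBALIZED CLASS IS COH-UNITARY** — `GlobalizationCohUnitaryStmt` BY NAME: if the `(𝔤,K)`-class `x` of `U(2,1)` has a unitary globalization
`ϖ`, then some representative `r` of `x` (namely the one `IsUnitaryGlobalization` provides, `(𝔤,K)`-equivalent to `H_K^∞(ϖ)`) is an irreducible admissible
`(𝔲(2,1),K)`-module unitary along `𝔭 ⊕ ℝz₀` (★ `IsCohUnitaryIrrep`): `(𝔤,K)` and irreducible by ★ `GKIrrep`, admissible by §1, unitary along `𝔭 ⊕ ℝz₀` by §1.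
U8e ED. 2 pays `sig_K2E1bGlobalizationCohUnitary := globalizationCohUnitary`. [cite: Rogawski1990, Prop. 13.8.1 p. 206] [cite: BorelWallach2000, 0 §2.5; II §2.1]
[cite: HarishChandra1953, §9 Thms. 4–6 and Thm. 8] -/
theorem globalizationCohUnitary : GlobalizationCohUnitaryStmt := by
  intro x E _ _ _ ϖ hϖ
  obtain ⟨hu, hc, r, hrx, heq⟩ := id hϖ
  exact ⟨r, hrx, ⟨r.isGKModule, r.isIrreducible, isAdmissibleGK_of_areGKEquivalent_harishChandra hϖ hc r heq,
    isUnitaryAlongP_of_areGKEquivalent_harishChandra hu hc r heq⟩⟩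

end Summit.HodgeConjecture.HodgeConjecture.Cruxes.H413.K2E1bGKCohomologyU21.U8

end
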